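import Summits.CriticalPhenomena.PercolationContinuityZ3.Theorems.PercNearOneGluingNoHeavyLowerTailSunflowerPrincipalCube
import Summits.CriticalPhenomena.PercolationContinuityZ3.Theorems.PercNearOneGluingNoHeavyLowerTailSunflowerCrossIntersecting
import HarnessLib
import HarnessLib.Audit

/-!
# `NoHeavyLowerTail` (crux stmt-CriticalPhenomena-4575), abstract sunflower cubic: the partition lemma ★ (`0 ≤ ZH`) — indeed LEMMA B
# (`Ntri ≤ 3·SB`) — for every sunflower one of whose petals has a LEAST ELEMENT; (R2) for three up-sets one of which is principal

Support file (seat `prim-l12-p2` gen 13; `--supports stmt-CriticalPhenomena-4575`).  Nothing is asserted about the crux; no `sorry`, no named facts.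
Memo: run/shared/lean/prim/prim-l12/prim-l12-p2/FINDING-g13-PRINCIPAL-PETAL.md.  Companion (the new inequality): `…SunflowerPrincipalCube`.

`ZH = 3(SA + SB) − Ntri` (`Sunflower.ZH_eq_SA_SB`): the partition lemma `PartitionLemmaH` (★, OPEN in general; ⇒ `H_{q+t}`, `GammaRow`, `G₄` via
the tree) says the kernel-spectator (`SA ≥ 0`) and bottom-spectator (`SB ≥ 0`) antipodal-Gladkov surpluses pay for the rainbow partitions `Ntri`;
"Lemma B" `Ntri ≤ 3·SB` alone is FALSE (doubled star, `…SunflowerPartitionLemmaBRefutation`).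

THEOREMS (this file).
* `Sunflower.N123_le_N140` (EVERY sunflower): rainbows `(1,2,3)` are at most the `(1,⊤,0)` partitions (antipodal Gladkov in the cube of a
  petal-`0` spectator, `Sw 1_{1} ≥ 0`, and `kk ≤ [⊤0]+[0⊤]−[23]−[32]` pointwise).
* `Sunflower.two_N140_le_SB`: if petal `0` has a least element `g ≠ ∅` (`g ∈ V 0`, every petal-`0` set contains `g`) then `2·N140 ≤ SB`
  (block rotation `N140 = N014 = N041` and the cube inequality `Sunflower.cube_le` of the companion file in the complement of every bottom spectator).
* **`Sunflower.Ntri_le_three_SB_of_least`** (Lemma B) and **`Sunflower.ZH_nonneg_of_least`** (★) for petal `0` with a least element;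
  `Sunflower.ZH_nonneg_of_least_petal` for any petal `i` (cyclic relabelling `Sunflower.rotate`, `rotate_ZH`).
* **`ZH_ofUpsets_nonneg_of_principal`** / `ZH_ofUpsets_principal_slot_nonneg`: (R2) (`ThreeUpsetPartitionIneq`-shape) for up-sets `U 0, U 1, U 2`
  one of which is a PRINCIPAL filter `↑g`, the other two arbitrary — rainbows allowed (prove-1's `ZH_ofUpsets_principal_nonneg` needed two
  meeting principal generators, i.e. no rainbows).  Covers every star-type composition, every product-type composition with a principal factor,
  and in the census language "one principal petal": all known Lemma-B violators have three non-principal (non-intersecting) petals.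
-/

namespace Summit.CriticalPhenomena.PercolationContinuityZ3.Theorems.SunflowerPartition

open Finset

variable {α : Type*} [Fintype α] [DecidableEq α]

namespace Sunflower

variable (F : Sunflower α)

/-! ## Counting consequences: `N123 ≤ N140`, `2·N140 ≤ SB`, Lemma B and the partition lemma -/

/-- `N140` = number of ordered 3-partitions labelled `(1, ⊤, 0)` (petal `0`, kernel, bottom). [this work] -/
def N140 : ℤ := ∑ q ∈ parts α, (if F.lab q.1 = 1 ∧ F.lab q.2 = 4 ∧ F.lab (q.1 ∪ q.2)ᶜ = 0 then (1 : ℤ) else 0)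

/-- Pointwise kernel bound behind `N123 ≤ N140`. [this work] -/
theorem ind1_mul_kk_le : ∀ x y z : Fin 5, (if x = 1 then (1 : ℤ) else 0) * kk y z ≤
    (if x = 1 ∧ y = 4 ∧ z = 0 then (1 : ℤ) else 0) + (if x = 1 ∧ z = 4 ∧ y = 0 then (1 : ℤ) else 0) - rind x y z - rind x z y := by
  decide

/-- **`N123 ≤ N140`** for EVERY sunflower: in the cube of a petal-`0` spectator, antipodal Gladkov bounds the `(2,3)` pairs by the `(⊤,0)`
pairs. [this work] -/
theorem N123_le_N140 : F.N123 ≤ F.N140 := by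
  have h0 := F.Sw_nonneg (fun v => if v = 1 then 1 else 0) (fun v => by split_ifs <;> norm_num)
  have e104 : (∑ q ∈ parts α, (if F.lab q.1 = 1 ∧ F.lab (q.1 ∪ q.2)ᶜ = 4 ∧ F.lab q.2 = 0 then (1 : ℤ) else 0)) = F.N140 := by
    unfold N140
    exact sum_parts_swap23 (α := α) (fun a b c => if F.lab a = 1 ∧ F.lab c = 4 ∧ F.lab b = 0 then (1 : ℤ) else 0)
  have e132 : (∑ q ∈ parts α, rind (F.lab q.1) (F.lab (q.1 ∪ q.2)ᶜ) (F.lab q.2)) = F.N123 := by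
    unfold N123
    exact sum_parts_swap23 (α := α) (fun a b c => rind (F.lab a) (F.lab c) (F.lab b))
  have h1 : F.Sw (fun v => if v = 1 then 1 else 0) ≤ F.N140
      + (∑ q ∈ parts α, (if F.lab q.1 = 1 ∧ F.lab (q.1 ∪ q.2)ᶜ = 4 ∧ F.lab q.2 = 0 then (1 : ℤ) else 0))
      - F.N123 - (∑ q ∈ parts α, rind (F.lab q.1) (F.lab (q.1 ∪ q.2)ᶜ) (F.lab q.2)) := by
    unfold Sw N140 N123
    rw [← sum_add_distrib, ← sum_sub_distrib, ← sum_sub_distrib]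
    exact sum_le_sum fun q _ => ind1_mul_kk_le _ _ _
  linarith

/-- **`2·N140 ≤ SB`** under the least-element hypothesis: block rotation `N140 = N014 = N041` and the cube inequality in the complement of every
bottom spectator. [this work] -/
theorem two_N140_le_SB {g : Finset α} (hne : g.Nonempty) (hg : g ∈ F.V 0) (hC : ∀ S ∈ F.V 0, S ∉ F.A → g ⊆ S) :
    2 * F.N140 ≤ F.SB := by
  -- rotate the blocks: N140 = N014 and N140 = N041
  have e014 : F.N140 = ∑ q ∈ parts α, (if F.lab q.1 = 0 then (1 : ℤ) else 0) * ind14 (F.lab q.2) (F.lab (q.1 ∪ q.2)ᶜ) := by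
    rw [sum_parts_cyc (α := α) (fun a b c => (if F.lab a = 0 then (1 : ℤ) else 0) * ind14 (F.lab b) (F.lab c))]
    unfold N140 ind14
    refine sum_congr rfl fun q _ => ?_
    split_ifs <;> simp_all
  have e041 : F.N140 = ∑ q ∈ parts α, (if F.lab q.1 = 0 then (1 : ℤ) else 0) * ind14 (F.lab (q.1 ∪ q.2)ᶜ) (F.lab q.2) := by
    rw [sum_parts_swap13 (α := α) (fun a b c => (if F.lab a = 0 then (1 : ℤ) else 0) * ind14 (F.lab c) (F.lab b))]
    unfold N140 ind14
    refine sum_congr rfl fun q _ => ?_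
    split_ifs <;> simp_all
  have hsum : 2 * F.N140 = ∑ q ∈ parts α, (if F.lab q.1 = 0 then (1 : ℤ) else 0) *
      (ind14 (F.lab q.2) (F.lab (q.1 ∪ q.2)ᶜ) + ind14 (F.lab (q.1 ∪ q.2)ᶜ) (F.lab q.2)) := by
    have hs : (∑ q ∈ parts α, (if F.lab q.1 = 0 then (1 : ℤ) else 0) *
        (ind14 (F.lab q.2) (F.lab (q.1 ∪ q.2)ᶜ) + ind14 (F.lab (q.1 ∪ q.2)ᶜ) (F.lab q.2)))
        = (∑ q ∈ parts α, (if F.lab q.1 = 0 then (1 : ℤ) else 0) * ind14 (F.lab q.2) (F.lab (q.1 ∪ q.2)ᶜ))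
          + ∑ q ∈ parts α, (if F.lab q.1 = 0 then (1 : ℤ) else 0) * ind14 (F.lab (q.1 ∪ q.2)ᶜ) (F.lab q.2) := by
      rw [← sum_add_distrib]
      exact sum_congr rfl fun q _ => by ring
    rw [hs, ← e014, ← e041]
    ring
  rw [hsum]
  unfold SB Sw
  rw [sum_parts_eq (f := fun S T => (if F.lab S = 0 then (1 : ℤ) else 0) * (ind14 (F.lab T) (F.lab (S ∪ T)ᶜ) + ind14 (F.lab (S ∪ T)ᶜ) (F.lab T))),
    sum_parts_eq (f := fun S T => (if F.lab S = 0 then (1 : ℤ) else 0) * kk (F.lab T) (F.lab (S ∪ T)ᶜ))]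
  refine sum_le_sum fun S _ => ?_
  rw [← mul_sum, ← mul_sum]
  by_cases hS : F.lab S = 0
  · rw [if_pos hS, one_mul, one_mul]
    have h := F.cube_le hne hg hC Sᶜ
    have hl : ∑ T ∈ Sᶜ.powerset, (ind14 (F.lab T) (F.lab (S ∪ T)ᶜ) + ind14 (F.lab (S ∪ T)ᶜ) (F.lab T))
        = ∑ T ∈ Sᶜ.powerset, (ind14 (F.lab T) (F.lab (Sᶜ \ T)) + ind14 (F.lab (Sᶜ \ T)) (F.lab T)) :=
      sum_congr rfl fun T _ => by rw [compl_union, sdiff_eq_inter_compl]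
    have hr : ∑ T ∈ Sᶜ.powerset, kk (F.lab T) (F.lab (S ∪ T)ᶜ) = ∑ T ∈ Sᶜ.powerset, kk (F.lab T) (F.lab (Sᶜ \ T)) :=
      sum_congr rfl fun T _ => by rw [compl_union, sdiff_eq_inter_compl]
    rw [hl, hr]
    exact h
  · rw [if_neg hS, zero_mul, zero_mul]

/-- **LEMMA B for sunflowers whose petal `0` has a least element**: `Ntri ≤ 3·SB`. [this work] -/
theorem Ntri_le_three_SB_of_least {g : Finset α} (hg : g ∈ F.V 0) (hC : ∀ S ∈ F.V 0, S ∉ F.A → g ⊆ S) :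
    F.Ntri ≤ 3 * F.SB := by
  by_cases hne : g.Nonempty
  · have h1 := F.N123_le_N140
    have h2 := F.two_N140_le_SB hne hg hC
    have h3 := F.Ntri_eq_six_mul_N123
    linarith
  · -- `g = ∅`: everything lies in `V 0`, so `V 1 ⊆ A` and there are no rainbow partitions
    rw [not_nonempty_iff_eq_empty] at hne
    subst hne
    have hV1 : F.V 1 ⊆ F.A := fun S hS =>
      F.mem_A_of_mem_mem (i := 0) (j := 1) (by decide) (F.upper 0 (empty_subset S) hg) hS
    rw [F.Ntri_eq_zero_of_petal_empty 1 hV1]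
    have := F.SB_nonneg
    linarith

/-- **THE PARTITION LEMMA ★ for sunflowers whose petal `0` has a least element** (`g ∈ V 0` lying below every petal-`0` set): `0 ≤ ZH`.
[this work] -/
theorem ZH_nonneg_of_least {g : Finset α} (hg : g ∈ F.V 0) (hC : ∀ S ∈ F.V 0, S ∉ F.A → g ⊆ S) : 0 ≤ F.ZH := by
  rw [F.ZH_eq_SA_SB]
  have h1 := F.Ntri_le_three_SB_of_least hg hC
  have h2 := F.SA_nonneg
  linarith


/-! ## Petal relabelling: the same for petals `1` and `2` -/

/-- Cyclic relabelling of the petals: `V' = (V 1, V 2, V 0)`. [this work] -/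
def rotate : Sunflower α where
  V := ![F.V 1, F.V 2, F.V 0]
  upper := by
    intro i
    fin_cases i
    · exact F.upper 1
    · exact F.upper 2
    · exact F.upper 0
  inter_eq := by
    have hA : ∀ a b : Fin 3, a ≠ b → F.V a ∩ F.V b = F.V 1 ∩ F.V 2 := fun a b h => by
      rw [F.inter_eq a b h, F.inter_eq 1 2 (by decide)]
    intro i j hij
    fin_cases i <;> fin_cases j
    all_goals (first | exact absurd rfl hij | exact hA _ _ (by decide))

omit [Fintype α] in
/-- `rotate.V 0 = V 1`, `rotate.V 1 = V 2`, `rotate.V 2 = V 0`. [this work] -/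
theorem rotate_V : F.rotate.V 0 = F.V 1 ∧ F.rotate.V 1 = F.V 2 ∧ F.rotate.V 2 = F.V 0 := ⟨rfl, rfl, rfl⟩

omit [Fintype α] in
/-- The kernel is unchanged. [this work] -/
theorem rotate_A : F.rotate.A = F.A := by
  show F.V 1 ∩ F.V 2 = F.V 0 ∩ F.V 1
  exact F.inter_eq 1 2 (by decide)

/-- The induced permutation of `M₃`: petals `1 ↦ 3`, `2 ↦ 1`, `3 ↦ 2`. [this work] -/
def rot5 : Fin 5 → Fin 5 := ![0, 3, 1, 2, 4]

omit [Fintype α] in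
/-- Labels of the rotated sunflower. [this work] -/
theorem lab_rotate (S : Finset α) : F.rotate.lab S = rot5 (F.lab S) := by
  by_cases hA : S ∈ F.A
  · have h1 : F.rotate.lab S = 4 := (F.rotate.lab_eq_four_iff S).2 (by rw [rotate_A]; exact hA)
    have h2 : F.lab S = 4 := (F.lab_eq_four_iff S).2 hA
    rw [h1, h2]; rfl
  have hA' : S ∉ F.rotate.A := by rw [rotate_A]; exact hA
  have n4 : F.lab S ≠ 4 := fun h => hA ((F.lab_eq_four_iff S).1 h)
  have n4' : F.rotate.lab S ≠ 4 := fun h => hA' ((F.rotate.lab_eq_four_iff S).1 h)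
  by_cases h0 : S ∈ F.V 0
  · have h1 : F.lab S = 1 := ((F.lab_V0_iff S).2 h0).resolve_right n4
    have h2 : F.rotate.lab S = 3 := ((F.rotate.lab_V2_iff S).2 (by rw [F.rotate_V.2.2]; exact h0)).resolve_right n4'
    rw [h1, h2]; rfl
  by_cases h1 : S ∈ F.V 1
  · have e1 : F.lab S = 2 := ((F.lab_V1_iff S).2 h1).resolve_right n4
    have e2 : F.rotate.lab S = 1 := ((F.rotate.lab_V0_iff S).2 (by rw [F.rotate_V.1]; exact h1)).resolve_right n4'
    rw [e1, e2]; rfl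
  by_cases h2 : S ∈ F.V 2
  · have e1 : F.lab S = 3 := ((F.lab_V2_iff S).2 h2).resolve_right n4
    have e2 : F.rotate.lab S = 2 := ((F.rotate.lab_V1_iff S).2 (by rw [F.rotate_V.2.1]; exact h2)).resolve_right n4'
    rw [e1, e2]; rfl
  · have e1 : F.lab S = 0 := by
      unfold Sunflower.lab; rw [if_neg hA, if_neg h0, if_neg h1, if_neg h2]
    have e2 : F.rotate.lab S = 0 := by
      have h0' : S ∉ F.rotate.V 0 := by rw [F.rotate_V.1]; exact h1
      have h1' : S ∉ F.rotate.V 1 := by rw [F.rotate_V.2.1]; exact h2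
      have h2' : S ∉ F.rotate.V 2 := by rw [F.rotate_V.2.2]; exact h0
      unfold Sunflower.lab; rw [if_neg hA', if_neg h0', if_neg h1', if_neg h2']
    rw [e1, e2]; rfl

/-- `s6H` is invariant under the petal rotation. [this work] -/
theorem s6H_rot5 : ∀ x y z : Fin 5, s6H (rot5 x) (rot5 y) (rot5 z) = s6H x y z := by decide

/-- `ZH` is invariant under the petal rotation. [this work] -/
theorem rotate_ZH : F.rotate.ZH = F.ZH := by
  unfold ZH
  refine sum_congr rfl fun q _ => ?_
  rw [F.lab_rotate, F.lab_rotate, F.lab_rotate, s6H_rot5]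

/-- **★ for every sunflower with a least-element petal**: if some petal `i` has a least element `g` (`g ∈ V i` and every petal-`i` set contains
`g`), then `0 ≤ ZH`. [this work] -/
theorem ZH_nonneg_of_least_petal (i : Fin 3) {g : Finset α} (hg : g ∈ F.V i) (hC : ∀ S ∈ F.V i, S ∉ F.A → g ⊆ S) : 0 ≤ F.ZH := by
  fin_cases i
  · exact F.ZH_nonneg_of_least hg hC
  · -- petal 1: rotate once
    rw [← F.rotate_ZH]
    refine F.rotate.ZH_nonneg_of_least (g := g) (by rw [F.rotate_V.1]; exact hg) ?_
    intro S hS hSA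
    rw [F.rotate_V.1] at hS
    rw [rotate_A] at hSA
    exact hC S hS hSA
  · -- petal 2: rotate twice
    rw [← F.rotate_ZH, ← F.rotate.rotate_ZH]
    refine F.rotate.rotate.ZH_nonneg_of_least (g := g) (by rw [F.rotate.rotate_V.1, F.rotate_V.2.1]; exact hg) ?_
    intro S hS hSA
    rw [F.rotate.rotate_V.1, F.rotate_V.2.1] at hS
    rw [rotate_A, rotate_A] at hSA
    exact hC S hS hSA

end Sunflower

/-! ## The three-up-set form: (R2) with a PRINCIPAL up-set -/

/-- **(R2) / ★ for three up-sets one of which is principal**: for up-sets `U 0, U 1, U 2` with `U i = ↑g` a principal filter, the partition functional of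
the θ-pullback sunflower is `≥ 0`.  (No hypothesis on the other two up-sets; rainbows may be present.) [this work] -/
theorem ZH_ofUpsets_nonneg_of_principal (U : Fin 3 → Finset (Finset α)) (hU : ∀ i, IsUpperSet (U i : Set (Finset α))) (i : Fin 3)
    (g : Finset α) (hUi : ∀ S, S ∈ U i ↔ g ⊆ S) : 0 ≤ (ofUpsets U hU).ZH := by
  refine (ofUpsets U hU).ZH_nonneg_of_least_petal i (g := g) ?_ ?_
  · show g ∈ U i ∪ twoOf U
    exact mem_union_left _ ((hUi g).2 subset_rfl)
  · intro S hS hSA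
    exact (hUi S).1 (mem_U_of_mem_ofUpsets_V hU hS hSA)

/-- In particular with `principal g` in slot `i` and arbitrary up-sets elsewhere. [this work] -/
theorem ZH_ofUpsets_principal_slot_nonneg (U : Fin 3 → Finset (Finset α)) (hU : ∀ i, IsUpperSet (U i : Set (Finset α))) (i : Fin 3)
    (g : Finset α) (hUi : U i = principal g) : 0 ≤ (ofUpsets U hU).ZH :=
  ZH_ofUpsets_nonneg_of_principal U hU i g fun S => by rw [hUi, mem_principal]

end Summit.CriticalPhenomena.PercolationContinuityZ3.Theorems.SunflowerPartition
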